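import Summits.QuantumFields.YangMills.Theorems.LuscherReductionTwistedTraceScalingBOCoreTransfer
import Summits.QuantumFields.YangMills.Theorems.LuscherReductionOneSiteLevelsL2Pos
import HarnessLib

/-!
# (C1-δ) THE SLOW SMEARING WINDOW OF THE (C1a) STEP: the indicator of `{‖q(u_k) − 1‖ ≤ δu ∧ L³S₁(u) ≤ σ}` — measurable, a class function, with floor `1` on smaller windows and `I₀ > 0`
# (lane A of S-BASE, crux `TwistedTraceScaling` stmt-QuantumFields-20203, C4-CORE, the (OD) pen; `pub/ym-fleet/ym-luscher-20007-p1/COARSE-DESIGN.md` §27.8, §29)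

The smearing amplitude `χ₀` of `…BOCentralSmearing.central_transfer_smeared_two_sided` is free; the (C1) theorem `…BOCentralTransfer.central_transfer_two_sided_chart` needs of it: measurable,
`0 ≤ χ₀ ≤ C_χ`, class function (`hχinv`), window support (`hχw`), a floor `χ_lo ≤ χ₀` on the `5Mδ`-window (`hχlo`), and `I₀ = ∫ χ₀(u)K(1,u)/K(1,1) dμ(u) > 0` (`hI0`).  All hold for the
INDICATOR window (written inline, no new definition) `χ_{δu,σ} = 𝟙{u | (∀ k, ‖q(u(0,k)) − 1‖ ≤ δu) ∧ L³·S₁(u) ≤ σ}` with `C_χ = χ_lo = 1`: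
`measurable_slowWindow`, `slowWindow_mem_Icc`, `slowWindow_conj`, `slowWindow_support`, `slowWindow_floor`, ★ `slowWindow_I0_pos` (`δu, σ > 0`; Haar charges the open window around `1`).
HONEST FRAMING: bookkeeping for a stub of a child of the CONDITIONAL route R2b1; (C1) rates, (C4), (C5), (B-ST) OPEN; C4-CORE OPEN; not infinite volume, not a gap, not Clay.
-/

set_option autoImplicit false

noncomputable section

open MeasureTheory Filter Topology Real
open scoped BigOperators
open Literature.MathematicalPhysics.QuantumFieldTheory
open Literature.MathematicalPhysics.QuantumLattice
open Literature.MathematicalPhysics.QuantumFieldTheory.Balaban1983to89.T4HaarSU2Translate (continuous_su2Quat su2Quat_one)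

namespace Summit.QuantumFields.YangMills.Theorems.FemtoTransferGap.TwoLattice.ConstTube

open Summit.QuantumFields.YangMills.Theorems.FemtoTransferGap
open Summit.QuantumFields.YangMills.Theorems.FemtoTransferGap.TwoLattice

variable {L : ℕ}

/-- The closed slow window is measurable. [folklore] -/
theorem measurableSet_slowWindow (δu σ : ℝ) :
    MeasurableSet {u : GaugeConfig 3 1 SU2 | (∀ k : Fin 3, ‖su2Quat (u (0, k)) - 1‖ ≤ δu) ∧ (L : ℝ) ^ 3 * wilsonAction su2Rep u ≤ σ} := by
  have h1 : ∀ k : Fin 3, MeasurableSet {u : GaugeConfig 3 1 SU2 | ‖su2Quat (u (0, k)) - 1‖ ≤ δu} := fun k =>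
    measurableSet_le ((continuous_norm.comp ((continuous_su2Quat.comp (continuous_apply (((0 : Site 3 1), k) : Edge 3 1))).sub continuous_const)).measurable) measurable_const
  have h2 : MeasurableSet {u : GaugeConfig 3 1 SU2 | (L : ℝ) ^ 3 * wilsonAction su2Rep u ≤ σ} :=
    measurableSet_le (measurable_const.mul (continuous_wilsonAction_of_continuous (d := 3) (L := 1) su2Rep continuous_su2Rep).measurable) measurable_const
  have heq : {u : GaugeConfig 3 1 SU2 | (∀ k : Fin 3, ‖su2Quat (u (0, k)) - 1‖ ≤ δu) ∧ (L : ℝ) ^ 3 * wilsonAction su2Rep u ≤ σ} =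
      (⋂ k : Fin 3, {u : GaugeConfig 3 1 SU2 | ‖su2Quat (u (0, k)) - 1‖ ≤ δu}) ∩ {u | (L : ℝ) ^ 3 * wilsonAction su2Rep u ≤ σ} := by
    ext u; simp
  rw [heq]; exact (MeasurableSet.iInter h1).inter h2

/-- The indicator window is measurable. [folklore] -/
theorem measurable_slowWindow (δu σ : ℝ) :
    Measurable ({u : GaugeConfig 3 1 SU2 | (∀ k : Fin 3, ‖su2Quat (u (0, k)) - 1‖ ≤ δu) ∧ (L : ℝ) ^ 3 * wilsonAction su2Rep u ≤ σ}.indicator fun _ => (1 : ℝ)) :=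
  measurable_const.indicator (measurableSet_slowWindow δu σ)

/-- `0 ≤ χ ≤ 1` and `|χ| ≤ 1`. [folklore] -/
theorem slowWindow_mem_Icc (δu σ : ℝ) (u : GaugeConfig 3 1 SU2) :
    0 ≤ {u : GaugeConfig 3 1 SU2 | (∀ k : Fin 3, ‖su2Quat (u (0, k)) - 1‖ ≤ δu) ∧ (L : ℝ) ^ 3 * wilsonAction su2Rep u ≤ σ}.indicator (fun _ => (1 : ℝ)) u ∧
      {u : GaugeConfig 3 1 SU2 | (∀ k : Fin 3, ‖su2Quat (u (0, k)) - 1‖ ≤ δu) ∧ (L : ℝ) ^ 3 * wilsonAction su2Rep u ≤ σ}.indicator (fun _ => (1 : ℝ)) u ≤ 1 ∧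
      |{u : GaugeConfig 3 1 SU2 | (∀ k : Fin 3, ‖su2Quat (u (0, k)) - 1‖ ≤ δu) ∧ (L : ℝ) ^ 3 * wilsonAction su2Rep u ≤ σ}.indicator (fun _ => (1 : ℝ)) u| ≤ 1 := by
  by_cases hu : u ∈ {u : GaugeConfig 3 1 SU2 | (∀ k : Fin 3, ‖su2Quat (u (0, k)) - 1‖ ≤ δu) ∧ (L : ℝ) ^ 3 * wilsonAction su2Rep u ≤ σ}
  · rw [Set.indicator_of_mem hu]; norm_num
  · rw [Set.indicator_of_notMem hu]; norm_num

/-- The window is a class function: invariant under global colour conjugation. [folklore] -/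
theorem slowWindow_conj (δu σ : ℝ) (c : SU2) (u : GaugeConfig 3 1 SU2) :
    {u : GaugeConfig 3 1 SU2 | (∀ k : Fin 3, ‖su2Quat (u (0, k)) - 1‖ ≤ δu) ∧ (L : ℝ) ^ 3 * wilsonAction su2Rep u ≤ σ}.indicator (fun _ => (1 : ℝ))
        (gaugeTransform (fun _ : Site 3 1 => c) u) =
      {u : GaugeConfig 3 1 SU2 | (∀ k : Fin 3, ‖su2Quat (u (0, k)) - 1‖ ≤ δu) ∧ (L : ℝ) ^ 3 * wilsonAction su2Rep u ≤ σ}.indicator (fun _ => (1 : ℝ)) u := by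
  have hmem : gaugeTransform (fun _ : Site 3 1 => c) u ∈ {u : GaugeConfig 3 1 SU2 | (∀ k : Fin 3, ‖su2Quat (u (0, k)) - 1‖ ≤ δu) ∧ (L : ℝ) ^ 3 * wilsonAction su2Rep u ≤ σ} ↔
      u ∈ {u : GaugeConfig 3 1 SU2 | (∀ k : Fin 3, ‖su2Quat (u (0, k)) - 1‖ ≤ δu) ∧ (L : ℝ) ^ 3 * wilsonAction su2Rep u ≤ σ} := by
    simp only [Set.mem_setOf_eq, wilsonAction_gaugeTransform]
    have hk : ∀ k : Fin 3, ‖su2Quat (gaugeTransform (fun _ : Site 3 1 => c) u (0, k)) - 1‖ = ‖su2Quat (u (0, k)) - 1‖ := fun k => by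
      show ‖su2Quat (c * u (0, k) * c⁻¹) - 1‖ = _
      exact norm_su2Quat_conj_sub_one c _
    simp only [hk]
  by_cases hu : u ∈ {u : GaugeConfig 3 1 SU2 | (∀ k : Fin 3, ‖su2Quat (u (0, k)) - 1‖ ≤ δu) ∧ (L : ℝ) ^ 3 * wilsonAction su2Rep u ≤ σ}
  · rw [Set.indicator_of_mem hu, Set.indicator_of_mem (hmem.2 hu)]
  · rw [Set.indicator_of_notMem hu, Set.indicator_of_notMem (fun h => hu (hmem.1 h))]

/-- Support: `χ u ≠ 0 →` the window conditions. [folklore] -/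
theorem slowWindow_support (δu σ : ℝ) (u : GaugeConfig 3 1 SU2)
    (hu : {u : GaugeConfig 3 1 SU2 | (∀ k : Fin 3, ‖su2Quat (u (0, k)) - 1‖ ≤ δu) ∧ (L : ℝ) ^ 3 * wilsonAction su2Rep u ≤ σ}.indicator (fun _ => (1 : ℝ)) u ≠ 0) :
    (∀ k : Fin 3, ‖su2Quat (u (0, k)) - 1‖ ≤ δu) ∧ (L : ℝ) ^ 3 * wilsonAction su2Rep u ≤ σ := by
  by_contra h
  have hnot : u ∉ {u : GaugeConfig 3 1 SU2 | (∀ k : Fin 3, ‖su2Quat (u (0, k)) - 1‖ ≤ δu) ∧ (L : ℝ) ^ 3 * wilsonAction su2Rep u ≤ σ} := h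
  exact hu (Set.indicator_of_notMem hnot _)

/-- Floor: on the smaller window `‖q(u_k) − 1‖ ≤ a ≤ δu`, `S₁(u) ≤ b` with `L³b ≤ σ`, `χ u = 1 ≥ 1`. [folklore] -/
theorem slowWindow_floor {δu σ a b : ℝ} (ha : a ≤ δu) (hb : (L : ℝ) ^ 3 * b ≤ σ) (u : GaugeConfig 3 1 SU2)
    (hu : ∀ k : Fin 3, ‖su2Quat (u (0, k)) - 1‖ ≤ a) (hS : wilsonAction su2Rep u ≤ b) :
    (1 : ℝ) ≤ {u : GaugeConfig 3 1 SU2 | (∀ k : Fin 3, ‖su2Quat (u (0, k)) - 1‖ ≤ δu) ∧ (L : ℝ) ^ 3 * wilsonAction su2Rep u ≤ σ}.indicator (fun _ => (1 : ℝ)) u := by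
  have hL3 : (0 : ℝ) ≤ (L : ℝ) ^ 3 := by positivity
  have hmem : u ∈ {u : GaugeConfig 3 1 SU2 | (∀ k : Fin 3, ‖su2Quat (u (0, k)) - 1‖ ≤ δu) ∧ (L : ℝ) ^ 3 * wilsonAction su2Rep u ≤ σ} :=
    ⟨fun k => (hu k).trans ha, (mul_le_mul_of_nonneg_left hS hL3).trans hb⟩
  rw [Set.indicator_of_mem hmem]

/-- ★ **`I₀ > 0`**: `0 < ∫ χ(u)·K(1,u)/K(1,1) dμ(u)` for `δu, σ > 0` (the integrand is non-negative, positive on the open window around `u = 1`, which the product Haar measure charges).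
[folklore] -/
theorem slowWindow_I0_pos {δu σ : ℝ} (hδu : 0 < δu) (hσ : 0 < σ) (B : ℝ) :
    0 < ∫ u, {u : GaugeConfig 3 1 SU2 | (∀ k : Fin 3, ‖su2Quat (u (0, k)) - 1‖ ≤ δu) ∧ (L : ℝ) ^ 3 * wilsonAction su2Rep u ≤ σ}.indicator (fun _ => (1 : ℝ)) u *
      (transferKernel su2Rep B (1 : GaugeConfig 3 1 SU2) u / transferKernel su2Rep B (1 : GaugeConfig 3 1 SU2) 1) ∂configMeasure SU2 1 := by
  haveI := configMeasure_isOpenPosMeasure (G := SU2) 1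
  haveI : IsProbabilityMeasure (configMeasure SU2 1) := by unfold configMeasure; infer_instance
  set W := {u : GaugeConfig 3 1 SU2 | (∀ k : Fin 3, ‖su2Quat (u (0, k)) - 1‖ ≤ δu) ∧ (L : ℝ) ^ 3 * wilsonAction su2Rep u ≤ σ} with hW
  have hK1 : 0 < transferKernel su2Rep B (1 : GaugeConfig 3 1 SU2) 1 := transferKernel_pos _ _ _ _
  obtain ⟨M1, hM1⟩ := exists_transferKernel_le su2Rep continuous_su2Rep B (L := 1)
  set f : GaugeConfig 3 1 SU2 → ℝ := fun u => W.indicator (fun _ => (1 : ℝ)) u * (transferKernel su2Rep B (1 : GaugeConfig 3 1 SU2) u / transferKernel su2Rep B (1 : GaugeConfig 3 1 SU2) 1) with hf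
  have hf0 : ∀ u, 0 ≤ f u := fun u => mul_nonneg (slowWindow_mem_Icc δu σ u).1 (div_nonneg (transferKernel_pos _ _ _ _).le hK1.le)
  have hKm : Measurable fun u : GaugeConfig 3 1 SU2 => transferKernel su2Rep B (1 : GaugeConfig 3 1 SU2) u := by
    have hK : Measurable fun p : GaugeConfig 3 1 SU2 × GaugeConfig 3 1 SU2 => transferKernel su2Rep B p.1 p.2 :=
      (continuous_transferKernel su2Rep continuous_su2Rep B).measurable
    have h1 : Measurable fun u : GaugeConfig 3 1 SU2 => ((1 : GaugeConfig 3 1 SU2), u) := measurable_const.prodMk measurable_id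
    have h := hK.comp h1
    simpa only [Function.comp_def] using h
  have hfm : Measurable f := (measurable_slowWindow δu σ).mul (hKm.div_const _)
  have hfb : ∀ u, |f u| ≤ 1 * (M1 / transferKernel su2Rep B (1 : GaugeConfig 3 1 SU2) 1) := fun u => by
    rw [hf]; dsimp only; rw [abs_mul]
    refine mul_le_mul (slowWindow_mem_Icc δu σ u).2.2 ?_ (abs_nonneg _) zero_le_one
    rw [abs_of_nonneg (div_nonneg (transferKernel_pos _ _ _ _).le hK1.le)]
    exact div_le_div_of_nonneg_right (hM1 _ _) hK1.le
  have hint : Integrable f (configMeasure SU2 1) := integrable_of_measurable_abs_le _ hfm hfb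
  show 0 < ∫ u, f u ∂configMeasure SU2 1
  rw [integral_pos_iff_support_of_nonneg hf0 hint]
  -- the open window around `1` lies in the support
  set O := {u : GaugeConfig 3 1 SU2 | (∀ k : Fin 3, ‖su2Quat (u (0, k)) - 1‖ < δu) ∧ (L : ℝ) ^ 3 * wilsonAction su2Rep u < σ} with hO
  have hOopen : IsOpen O := by
    have h1 : ∀ k : Fin 3, IsOpen {u : GaugeConfig 3 1 SU2 | ‖su2Quat (u (0, k)) - 1‖ < δu} := fun k =>
      isOpen_lt (continuous_norm.comp ((continuous_su2Quat.comp (continuous_apply (((0 : Site 3 1), k) : Edge 3 1))).sub continuous_const)) continuous_const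
    have h2 : IsOpen {u : GaugeConfig 3 1 SU2 | (L : ℝ) ^ 3 * wilsonAction su2Rep u < σ} :=
      isOpen_lt (continuous_const.mul (continuous_wilsonAction_of_continuous (d := 3) (L := 1) su2Rep continuous_su2Rep)) continuous_const
    have heq : O = (⋂ k : Fin 3, {u : GaugeConfig 3 1 SU2 | ‖su2Quat (u (0, k)) - 1‖ < δu}) ∩ {u | (L : ℝ) ^ 3 * wilsonAction su2Rep u < σ} := by
      ext u; simp [hO]
    rw [heq]; exact (isOpen_iInter_of_finite h1).inter h2
  have h1O : (1 : GaugeConfig 3 1 SU2) ∈ O := by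
    refine ⟨fun k => ?_, ?_⟩
    · show ‖su2Quat (1 : SU2) - 1‖ < δu
      rw [su2Quat_one, sub_self, norm_zero]; exact hδu
    · rw [wilsonAction_one_eq_zero (ρ := su2Rep), mul_zero]; exact hσ
  have hOsupp : O ⊆ Function.support f := fun u hu => by
    rw [Function.mem_support, hf]; dsimp only
    have hmem : u ∈ W := ⟨fun k => (hu.1 k).le, hu.2.le⟩
    rw [Set.indicator_of_mem hmem, one_mul]
    exact (div_pos (transferKernel_pos _ _ _ _) hK1).ne'
  exact lt_of_lt_of_le (hOopen.measure_pos _ ⟨1, h1O⟩) (measure_mono hOsupp)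

end Summit.QuantumFields.YangMills.Theorems.FemtoTransferGap.TwoLattice.ConstTube

end
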